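import Summits.Ventures.Crystal3D.Theorems.StickyWulffConstantNoReconstructionGainLowCoordAdhesion
import HarnessLib

/-!
# The flat-profile method in its global form: total load and discharging

HONEST FRAMING. Part of the venture `Summits/Ventures/Crystal3D` (cell `crystal3d-full`), helper
`--supports` the crux `NoReconstructionGain` (stmt-Ventures-19144, route
`route-Ventures-StickyWulffConstant`), line `adhesion`.  This is the METHOD THEOREM behind the
pointwise rungs `lowCoordAdhesion111_nine` / `adhesion111_of_localSteepBalance`
(`…LowCoordAdhesion`, `…LocalRuleAdhesion`): with the slab sample `P` at `ν = e₃` (`R = 4`), the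
slab potential `Φ(y) = max (y₂ + 5h, −9h − y₂, 0)` (`h = √(2/3)`) and the flat-profile LOAD of a
non-sample ball `q`,
`F(q) = 2·#{x ∼ q : Φx − Φq ≤ −h} + #{x ∼ q : −h < Φx − Φq < h}`,
the identity `Σ_{q ∈ Q} F(q) = orderedContacts Q + Σ_cross w` gives

* `adhesion111_of_flatLoadSum` — if the TOTAL load satisfies `Σ_{q ∈ X \ P} F(q) ≤ 12·#(X \ P) + B`
  then `cross ≤ D(X \ P) + 450 π ρ + B/2` (no pointwise hypothesis: overloaded balls may be paid
  for by underloaded ones anywhere in the overlayer);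
* `adhesion111_of_transfer` — DISCHARGING form: if some antisymmetric transfer `τ` on pairs of
  non-sample balls makes every ball's corrected load `F(q) + Σ_x τ q x ≤ 12`, the atom holds with
  `C = 450 π`.  Radius-`r` charging rules (p1 g12 memo §5; cf-p2 transport LPs) land here.

WHAT THIS IS NOT: any new class of overlayers by itself (it is the landing spot for non-pointwise
rules); rung F-C1 not moved.
-/

noncomputable section

namespace Summit.Ventures.Crystal3D.Theorems

open Summit.Ventures.Crystal3D Finset Real
open Literature.MathematicalPhysics.StatisticalMechanics (fccStacking orderedContacts
  contactDeficiency)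
open scoped InnerProductSpace

/-- **Global flat-load form of the adhesion atom at `ν = e₃`.**  `P` the slab sample (`R = 4`,
`ρ ≥ 4`) in a finite unit packing `X`, `Φ` the slab potential, `h = √(2/3)`.  If
`Σ_{q ∈ X \ P} (2·#{x ∈ X : x ∼ q, Φx − Φq ≤ −h} + #{x ∈ X : x ∼ q, −h < Φx − Φq < h})
 ≤ 12·#(X \ P) + B`, then `#{(p,q) ∈ P × (X \ P) : dist p q = 1} ≤ D(X \ P) + 450 π ρ + B/2`. -/
theorem adhesion111_of_flatLoadSum (ρ : ℝ) (hρ : 4 ≤ ρ) (X P : Finset (EuclideanSpace ℝ (Fin 3)))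
    (hX : ∀ p ∈ X, ∀ q ∈ X, p ≠ q → 1 ≤ dist p q) (hPX : P ⊆ X)
    (hP : ∀ p, p ∈ P ↔ (p ∈ fccStacking 1 (Real.sqrt (2 / 3)) ∧
      -(2 * 4) ≤ ⟪p, EuclideanSpace.single (2 : Fin 3) (1 : ℝ)⟫_ℝ ∧
      ⟪p, EuclideanSpace.single (2 : Fin 3) (1 : ℝ)⟫_ℝ ≤ -4 ∧
      ‖p‖ ^ 2 - ⟪p, EuclideanSpace.single (2 : Fin 3) (1 : ℝ)⟫_ℝ ^ 2 ≤ ρ ^ 2))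
    (Φ : EuclideanSpace ℝ (Fin 3) → ℝ)
    (hΦ : ∀ y, Φ y = max (y 2 + 5 * Real.sqrt (2 / 3)) (max (-(9 * Real.sqrt (2 / 3)) - y 2) 0))
    (B : ℝ)
    (hload : ∑ q ∈ X \ P,
      (2 * ((X.filter fun x => dist q x = 1 ∧ Φ x - Φ q ≤ -Real.sqrt (2 / 3)).card : ℝ) +
        ((X.filter fun x => dist q x = 1 ∧ -Real.sqrt (2 / 3) < Φ x - Φ q ∧
          Φ x - Φ q < Real.sqrt (2 / 3)).card : ℝ)) ≤ 12 * ((X \ P).card : ℝ) + B) :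
    ((((P ×ˢ (X \ P)).filter fun pq => dist pq.1 pq.2 = 1).card : ℕ) : ℝ) ≤
      contactDeficiency (X \ P) + 450 * Real.pi * ρ + B / 2 := by
  classical
  obtain ⟨hh2, hh45, hh89⟩ := sqrt_two_thirds_bounds
  set h : ℝ := Real.sqrt (2 / 3) with hhdef
  have hhpos : 0 < h := by linarith
  -- the sample in coordinates
  have hinner : ∀ p : EuclideanSpace ℝ (Fin 3), ⟪p, EuclideanSpace.single (2 : Fin 3) (1 : ℝ)⟫_ℝ = p 2 :=
    fun p => by simp [EuclideanSpace.inner_single_right]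
  have hlat : ∀ p : EuclideanSpace ℝ (Fin 3), ‖p‖ ^ 2 - (p 2) ^ 2 = p 0 ^ 2 + p 1 ^ 2 := fun p => by
    rw [EuclideanSpace.real_norm_sq_eq, Fin.sum_univ_three]; ring
  have hP' : ∀ p, p ∈ P ↔ (p ∈ fccStacking 1 (Real.sqrt (2 / 3)) ∧ -8 ≤ p 2 ∧ p 2 ≤ -4 ∧
      p 0 ^ 2 + p 1 ^ 2 ≤ ρ ^ 2) := by
    intro p
    rw [hP p, hinner, hlat]
    constructor
    · rintro ⟨a, b, c, d⟩; exact ⟨a, by linarith, by linarith, d⟩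
    · rintro ⟨a, b, c, d⟩; exact ⟨a, by linarith, by linarith, d⟩
  have hΦ0 : ∀ y, 0 ≤ Φ y := fun y => by rw [hΦ]; exact le_trans (le_max_right _ _) (le_max_right _ _)
  have hΦP : ∀ p ∈ P, Φ p = 0 := by
    intro p hp
    obtain ⟨hΛ, h1, h2, -⟩ := (hP' p).1 hp
    obtain ⟨hz1, hz2⟩ := slab_height_bounds hΛ h1 h2
    rw [hΦ, max_eq_right (le_trans (by linarith) (le_max_right _ _)), max_eq_right (by linarith)]
  -- the flat-profile weights
  set w : EuclideanSpace ℝ (Fin 3) → EuclideanSpace ℝ (Fin 3) → ℝ := fun q x =>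
    if Φ x - Φ q ≤ -h then 2 else if Φ x - Φ q < h then 1 else 0 with hwdef
  have hw_symm : ∀ q x, w q x + w x q = 2 := by
    intro q x
    simp only [hwdef]
    have e : Φ q - Φ x = -(Φ x - Φ q) := by ring
    rw [e]
    rcases le_or_gt (Φ x - Φ q) (-h) with h1 | h1
    · rw [if_pos h1, if_neg (by linarith), if_neg (by linarith)]; norm_num
    · rw [if_neg (not_le.2 h1)]
      rcases lt_or_ge (Φ x - Φ q) h with h2 | h2
      · rw [if_pos h2, if_neg (by linarith), if_pos (by linarith)]; norm_num
      · rw [if_neg (not_lt.2 h2), if_pos (by linarith)]; norm_num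
  set Q := X \ P with hQ
  have hQX : ∀ q ∈ Q, q ∈ X ∧ q ∉ P := fun q hq => mem_sdiff.1 hq
  -- (1) the load of a ball is the sum of its weights
  have hloadq : ∀ q, ∑ x ∈ X, (if dist q x = 1 then w q x else 0) =
      2 * ((X.filter fun x => dist q x = 1 ∧ Φ x - Φ q ≤ -h).card : ℝ) +
        ((X.filter fun x => dist q x = 1 ∧ -h < Φ x - Φ q ∧ Φ x - Φ q < h).card : ℝ) := by
    intro q
    rw [← sum_filter]
    have e : ∀ x, w q x =
        2 * (if Φ x - Φ q ≤ -h then (1 : ℝ) else 0) +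
          (if -h < Φ x - Φ q ∧ Φ x - Φ q < h then 1 else 0) := by
      intro x
      simp only [hwdef]
      by_cases h1 : Φ x - Φ q ≤ -h
      · rw [if_pos h1, if_pos h1, if_neg (fun hh => by linarith [hh.1])]; norm_num
      · rw [if_neg h1, if_neg h1]
        by_cases h2 : Φ x - Φ q < h
        · rw [if_pos h2, if_pos ⟨not_le.1 h1, h2⟩]; norm_num
        · rw [if_neg h2, if_neg (fun hh => h2 hh.2)]; norm_num
    rw [sum_congr rfl (fun x _ => e x), sum_add_distrib, ← mul_sum, sum_boole, sum_boole,
      filter_filter, filter_filter]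
  have h12 : ∑ q ∈ Q, ∑ x ∈ X, (if dist q x = 1 then w q x else 0) ≤ 12 * (Q.card : ℝ) + B := by
    rw [sum_congr rfl (fun q _ => hloadq q)]; exact hload
  -- (2) split the inner sum over `X = Q ∪ P`
  have hXQP : X = Q ∪ P := by rw [hQ, sdiff_union_of_subset hPX]
  have hdisj : Disjoint Q P := by rw [hQ]; exact sdiff_disjoint
  have hsplit : ∑ q ∈ Q, ∑ x ∈ X, (if dist q x = 1 then w q x else 0) =
      (∑ q ∈ Q, ∑ x ∈ Q, (if dist q x = 1 then w q x else 0)) +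
        ∑ q ∈ Q, ∑ p ∈ P, (if dist q p = 1 then w q p else 0) := by
    rw [← sum_add_distrib]
    refine sum_congr rfl fun q _ => ?_
    rw [hXQP, sum_union hdisj]
  -- (2a) the `Q`-`Q` part is `orderedContacts Q`
  have hQQ : ∑ q ∈ Q, ∑ x ∈ Q, (if dist q x = 1 then w q x else 0) = (orderedContacts Q : ℝ) := by
    set S := ∑ q ∈ Q, ∑ x ∈ Q, (if dist q x = 1 then w q x else 0) with hS
    have hS' : S = ∑ q ∈ Q, ∑ x ∈ Q, (if dist q x = 1 then w x q else 0) := by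
      rw [hS, sum_comm]
      refine sum_congr rfl fun x _ => sum_congr rfl fun q _ => ?_
      rw [dist_comm]
    have hsum2 : (∑ q ∈ Q, ∑ x ∈ Q, (if dist q x = 1 then w q x else 0)) +
        (∑ q ∈ Q, ∑ x ∈ Q, (if dist q x = 1 then w x q else 0)) =
        ∑ q ∈ Q, ∑ x ∈ Q, (if dist q x = 1 then (2 : ℝ) else 0) := by
      rw [← sum_add_distrib]
      refine sum_congr rfl fun q _ => ?_
      rw [← sum_add_distrib]
      refine sum_congr rfl fun x _ => ?_
      by_cases hqx : dist q x = 1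
      · rw [if_pos hqx, if_pos hqx, if_pos hqx]; exact hw_symm q x
      · rw [if_neg hqx, if_neg hqx, if_neg hqx]; norm_num
    have h2S : 2 * S = ∑ q ∈ Q, ∑ x ∈ Q, (if dist q x = 1 then (2 : ℝ) else 0) := by
      rw [two_mul, ← hsum2, ← hS', hS]
    rw [orderedContacts_eq_sum_sum]
    have : ∑ q ∈ Q, ∑ x ∈ Q, (if dist q x = 1 then (2 : ℝ) else 0) =
        2 * ∑ q ∈ Q, ∑ x ∈ Q, (if dist q x = 1 then (1 : ℝ) else 0) := by
      rw [mul_sum]; refine sum_congr rfl fun q _ => ?_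
      rw [mul_sum]; refine sum_congr rfl fun x _ => ?_
      split_ifs <;> norm_num
    linarith
  -- (2b) the cross part: weight `2` except at rim sites
  set rim := P.filter fun p => (ρ - 2) ^ 2 < p 0 ^ 2 + p 1 ^ 2 with hrim
  have hwP : ∀ q ∈ Q, ∀ p ∈ P, dist q p = 1 →
      (2 : ℝ) - (if p ∈ rim then 1 else 0) ≤ w q p := by
    intro q hq p hp hqp
    have hΦp := hΦP p hp
    show (2 : ℝ) - (if p ∈ rim then 1 else 0) ≤
      (if Φ p - Φ q ≤ -h then 2 else if Φ p - Φ q < h then 1 else 0)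
    rw [hΦp, zero_sub]
    by_cases hge : h ≤ Φ q
    · rw [if_pos (show -Φ q ≤ -h by linarith)]
      by_cases hpr : p ∈ rim
      · rw [if_pos hpr]; norm_num
      · rw [if_neg hpr]; norm_num
    · have hlt := not_le.1 hge
      rw [if_neg (show ¬ (-Φ q ≤ -h) from not_le.2 (by linarith)),
        if_pos (show -Φ q < h by linarith [hΦ0 q])]
      have hprim : p ∈ rim := by
        rw [hrim, mem_filter]
        refine ⟨hp, ?_⟩
        exact rim_of_lowPotential_partner ρ hρ X P hX hPX hP' Φ hΦ p q (hQX q hq).1 (hQX q hq).2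
          (by rw [dist_comm]; exact hqp) hlt
      rw [if_pos hprim]; norm_num
  have hcross : ((((P ×ˢ Q).filter fun pq => dist pq.1 pq.2 = 1).card : ℕ) : ℝ) =
      ∑ q ∈ Q, ∑ p ∈ P, (if dist q p = 1 then (1 : ℝ) else 0) := by
    rw [card_crossContacts_eq_sum_sum, sum_comm]
    refine sum_congr rfl fun q _ => sum_congr rfl fun p _ => ?_
    rw [dist_comm]
  have hrim12 : ∑ q ∈ Q, ∑ p ∈ P, (if dist q p = 1 then (if p ∈ rim then (1 : ℝ) else 0) else 0)
      ≤ 12 * (rim.card : ℝ) := by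
    rw [sum_comm]
    have hz : ∀ p ∈ P, p ∉ rim →
        ∑ q ∈ Q, (if dist q p = 1 then (if p ∈ rim then (1 : ℝ) else 0) else 0) = 0 := by
      intro p _ hpr
      exact sum_eq_zero fun q _ => by simp [hpr]
    rw [← sum_filter_add_sum_filter_not P (fun p => p ∈ rim), sum_congr rfl (fun p hp =>
      hz p (mem_filter.1 hp).1 (mem_filter.1 hp).2), sum_const_zero, add_zero]
    have hPr : P.filter (fun p => p ∈ rim) = rim := by
      ext p; rw [mem_filter, hrim, mem_filter]; tauto
    rw [hPr]
    have hle : ∀ p ∈ rim, ∑ q ∈ Q, (if dist q p = 1 then (if p ∈ rim then (1 : ℝ) else 0) else 0)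
        ≤ 12 := by
      intro p hpr
      calc ∑ q ∈ Q, (if dist q p = 1 then (if p ∈ rim then (1 : ℝ) else 0) else 0)
          = ∑ q ∈ Q, (if dist p q = 1 then (1 : ℝ) else 0) := by
            refine sum_congr rfl fun q _ => ?_
            rw [if_pos hpr, dist_comm]
        _ = ((Q.filter fun q => dist p q = 1).card : ℝ) := by rw [sum_boole]
        _ ≤ ((X.filter fun q => dist p q = 1).card : ℝ) := by
            exact_mod_cast card_le_card (filter_subset_filter _ (by rw [hQ]; exact sdiff_subset))
        _ ≤ 12 := by exact_mod_cast card_partners_le_twelve X hX p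
    calc ∑ p ∈ rim, ∑ q ∈ Q, (if dist q p = 1 then (if p ∈ rim then (1 : ℝ) else 0) else 0)
        ≤ ∑ _p ∈ rim, (12 : ℝ) := sum_le_sum hle
      _ = 12 * (rim.card : ℝ) := by rw [sum_const, nsmul_eq_mul, mul_comm]
  have hQP : 2 * ((((P ×ˢ Q).filter fun pq => dist pq.1 pq.2 = 1).card : ℕ) : ℝ) -
      12 * (rim.card : ℝ) ≤ ∑ q ∈ Q, ∑ p ∈ P, (if dist q p = 1 then w q p else 0) := by
    rw [hcross, mul_sum]
    have hpt : ∀ q ∈ Q, 2 * ∑ p ∈ P, (if dist q p = 1 then (1 : ℝ) else 0) -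
        ∑ p ∈ P, (if dist q p = 1 then (if p ∈ rim then (1 : ℝ) else 0) else 0) ≤
        ∑ p ∈ P, (if dist q p = 1 then w q p else 0) := by
      intro q hq
      rw [mul_sum, ← sum_sub_distrib]
      refine sum_le_sum fun p hp => ?_
      by_cases hqp : dist q p = 1
      · rw [if_pos hqp, if_pos hqp, if_pos hqp]
        have := hwP q hq p hp hqp; linarith
      · rw [if_neg hqp, if_neg hqp, if_neg hqp]; norm_num
    have := sum_le_sum hpt
    rw [sum_sub_distrib] at this
    linarith [hrim12]
  -- (3) assemble
  have hrimle : (rim.card : ℝ) ≤ 75 * Real.pi * ρ := card_rim_le ρ hρ P hP'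
  have hmain : (orderedContacts Q : ℝ) +
      (2 * ((((P ×ˢ Q).filter fun pq => dist pq.1 pq.2 = 1).card : ℕ) : ℝ) -
        12 * (rim.card : ℝ)) ≤ 12 * (Q.card : ℝ) + B := by
    rw [← hQQ]; linarith [hsplit, h12, hQP]
  show ((((P ×ˢ Q).filter fun pq => dist pq.1 pq.2 = 1).card : ℕ) : ℝ) ≤
    contactDeficiency Q + 450 * Real.pi * ρ + B / 2
  unfold contactDeficiency
  nlinarith [hmain, hrimle, Real.pi_pos]

/-- **Discharging form.**  Same setting; if an ANTISYMMETRIC transfer `τ` between non-sample balls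
(`τ q x = −τ x q`) makes every non-sample ball's corrected flat load at most `12`,
`F(q) + Σ_{x ∈ X \ P} τ q x ≤ 12`, then the adhesion atom holds with `C = 450 π`. -/
theorem adhesion111_of_transfer (ρ : ℝ) (hρ : 4 ≤ ρ) (X P : Finset (EuclideanSpace ℝ (Fin 3)))
    (hX : ∀ p ∈ X, ∀ q ∈ X, p ≠ q → 1 ≤ dist p q) (hPX : P ⊆ X)
    (hP : ∀ p, p ∈ P ↔ (p ∈ fccStacking 1 (Real.sqrt (2 / 3)) ∧
      -(2 * 4) ≤ ⟪p, EuclideanSpace.single (2 : Fin 3) (1 : ℝ)⟫_ℝ ∧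
      ⟪p, EuclideanSpace.single (2 : Fin 3) (1 : ℝ)⟫_ℝ ≤ -4 ∧
      ‖p‖ ^ 2 - ⟪p, EuclideanSpace.single (2 : Fin 3) (1 : ℝ)⟫_ℝ ^ 2 ≤ ρ ^ 2))
    (Φ : EuclideanSpace ℝ (Fin 3) → ℝ)
    (hΦ : ∀ y, Φ y = max (y 2 + 5 * Real.sqrt (2 / 3)) (max (-(9 * Real.sqrt (2 / 3)) - y 2) 0))
    (τ : EuclideanSpace ℝ (Fin 3) → EuclideanSpace ℝ (Fin 3) → ℝ) (hτ : ∀ q x, τ q x = -τ x q)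
    (hrule : ∀ q ∈ X \ P,
      (2 * ((X.filter fun x => dist q x = 1 ∧ Φ x - Φ q ≤ -Real.sqrt (2 / 3)).card : ℝ) +
        ((X.filter fun x => dist q x = 1 ∧ -Real.sqrt (2 / 3) < Φ x - Φ q ∧
          Φ x - Φ q < Real.sqrt (2 / 3)).card : ℝ)) + ∑ x ∈ X \ P, τ q x ≤ 12) :
    ((((P ×ˢ (X \ P)).filter fun pq => dist pq.1 pq.2 = 1).card : ℕ) : ℝ) ≤
      contactDeficiency (X \ P) + 450 * Real.pi * ρ := by
  classical
  -- the transfers cancel in the total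
  have hcancel : ∑ q ∈ X \ P, ∑ x ∈ X \ P, τ q x = 0 := by
    have e : ∑ q ∈ X \ P, ∑ x ∈ X \ P, τ q x = ∑ q ∈ X \ P, ∑ x ∈ X \ P, τ x q := sum_comm
    have e' : ∑ q ∈ X \ P, ∑ x ∈ X \ P, τ x q = -∑ q ∈ X \ P, ∑ x ∈ X \ P, τ q x := by
      rw [← sum_neg_distrib]
      refine sum_congr rfl fun q _ => ?_
      rw [← sum_neg_distrib]
      exact sum_congr rfl fun x _ => by rw [hτ x q]
    linarith
  have hload : ∑ q ∈ X \ P,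
      (2 * ((X.filter fun x => dist q x = 1 ∧ Φ x - Φ q ≤ -Real.sqrt (2 / 3)).card : ℝ) +
        ((X.filter fun x => dist q x = 1 ∧ -Real.sqrt (2 / 3) < Φ x - Φ q ∧
          Φ x - Φ q < Real.sqrt (2 / 3)).card : ℝ)) ≤ 12 * ((X \ P).card : ℝ) + 0 := by
    have := sum_le_sum hrule
    rw [sum_add_distrib, hcancel, sum_const, nsmul_eq_mul] at this
    linarith
  have := adhesion111_of_flatLoadSum ρ hρ X P hX hPX hP Φ hΦ 0 hload
  linarith

end Summit.Ventures.Crystal3D.Theorems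

end
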